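/-
Copyright (c) 2026 the pub-hodgecm-mathlib formalisation cell (harness21).  Prover seat hodgecm-mathlib-K2E3-p31 (g3) on S4 dealer K2E2-plan (g7)'s DEAL (d′)
2026-09-05T01:47:05Z (chair K2-lead (g2) VALVE 13), Track B «K2-LIT», R90-TF section S4 (h413 = `stmt-HodgeConjecture-24833`), T-WIF road, (L2) ⇒ (L1) «BOREL TRANSVERSAL +
SHEET MEASURES» for R90-C131-p03 (g3)'s (B1) assembly (census `R90/R90-C131-p03/g3/CENSUS-B1-assembly.md` §2).  THEOREMS ONLY (no `def`, no `instance`, no notation, no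
named-fact hypothesis, no `sorry`); ★-only imports.
-/
import Summits.HodgeConjecture.HodgeConjecture.Theorems.R90S4EpsClassesOverNormFinite   -- ★ p863871 (K2E3-p27): `epsNorm_eq_one_of_mem_normFibre`, the (K-FIN)∕(IDX) binder shapes `hRT hRcov hRinj`; brings ★ α `R90S4TwistedCartanNormFibres`, ★ `R90S4CartanNormMap`
import Summits.HodgeConjecture.HodgeConjecture.Theorems.R90S4SplitFormHermitian          -- ★ `splitFormGL_isHermitian` (the `hΦ` letter at the form of record)
import Literature.NumberTheory.Rogawski1990.CMLocalAPacketMembers                         -- ★ `Gqs` (`U(Φ₃)(L⁺_v)`)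
import Literature.NumberTheory.Rogawski1990.LocalEndoscopicChartDatumCM                   -- ★ `isOpen_setOf_isRegularElt_cmDatum_local` (the regular locus is open, `v` non-split)
import Literature.Topology.Metrizable.LocallyCompactPolish                                -- ★ `polishSpace_of_locallyCompactSpace_of_secondCountableTopology`
import Mathlib.MeasureTheory.Constructions.Polish.Basic                                    -- Lusin–Souslin: `Measurable.measurableEmbedding`, `MeasurableSet.standardBorel`
import HarnessLib

/-!
# R90-TF · S4 «Ch. 13.1–2», T-WIF road, (L2) ⇒ (L1): THE BOREL TRANSVERSAL `B₀` OF `(1−ε)T̃` IN `T̃^{ε-reg}` AND ITS SHEET MEASURES, from a Borel norm section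
# (Rogawski 1990, §12.5 p. 186 «`Z̃T̃ᴺ ∖ T̃`, `dδ`»; Harish-Chandra 1970, Lemma 42; Lusin–Souslin)

Cell `hodgecm-mathlib`, crux H413 (`stmt-HodgeConjecture-24833`, lane `--supports … --as helper`), route of record `HCCMUnconditional` (no route verbs;
count-neutral).  Programme R90-TF, section S4 = [Rogawski1990] Ch. 13.1–13.2; S4 dealer K2E2-plan (g7), S4-R33 (a), DEAL (d′) to this seat; consumer R90-C131-p03 (g3)'s
(B1-T) `R90S4TwistedTubeFormula` ∕ (B1-Σ); paired with K2E5-p17 (g9)'s (L2) payer `R90S4BorelNormSection` (whose output `(s, hsm, hsT, hsN)` is taken HYPOTHESIS-FIRST here).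

THE POINT.  The twisted Weyl integration formula (B1) parametrises the ε-regular part of the torus `T̃ = Cent_{G̃_v}(γ)` (`γ ∈ G_v` regular, `T = Cent_{G_v}(γ)`) over a
TRANSVERSAL `B₀` of `(1−ε)T̃ = {a ε(a)⁻¹}` in `T̃^{ε-reg}` — the letter (L1) of ★ M1-TWIST `R90S4TwistedConjugationFamilyFibres` (binders `hB₀R hB₀inj hB₀cov`, p864149 :134–:136) —
and needs an EXPLICIT reference measure on it.  Given (L2) a Borel section `s : T → T̃` of the norm (`N(s t) = t`, K2E5-p17's `exists_measurable_epsNormSection`) and the finite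
transversal `R` of `K_T = T̃ᴺ ∕ (1−ε)T̃` ((K-FIN)∕(IDX), ★ p863871's `hRT hRcov hRinj`, ★ p863945 at non-split `v`), the SHEETS `σ_u : t ↦ s(t)·u` (`u ∈ R`) are injective
(`N(s(t)·u) = N(s t)·N(u) = t`, `N` multiplicative on the abelian `T̃`, ★ `epsNorm_mul_of_mem_centralizer`), pairwise disjoint, Borel — hence MEASURABLE EMBEDDINGS of the
standard Borel `T` (Lusin–Souslin) — and `B₀ := ⋃_{u ∈ R} σ_u(T^{reg})` is a Borel transversal; `λ := Σ_{u ∈ R} (σ_u)_*(t_T|_{T^{reg}})` is carried by `B₀` with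
`∫ F dλ = Σ_u ∫_{T^{reg}} F(s(t)·u) dt_T(t)` — print's «`dδ` on `Z̃T̃ᴺ∖T̃`» read sheet by sheet through the norm, Bochner-clean, no Federer on the torus side.
THE SHEET MAP is taken HYPOTHESIS-FIRST (`σ`, `hσ : ↑(σ u t) = s t * u` on `u ∈ T̃`; §0 `exists_normSheetMap` constructs it), so no `def` is needed and every head is a
statement about `(s, σ, R, t_T)`.
* §0 `exists_normSheetMap`; §1 `epsNorm_coe_normSheet` (`N(σ_u t) = t`), `normSheet_injective`, `disjoint_range_normSheet`.
* §2 THE (L1) LETTERS in ★ M1's shapes at `A := T̃`, `θ := ε_v`, `R := {δ | IsEpsRegularAt δ}`: **`normTransversal_mem_setOf_isEpsRegularAt`** (`hB₀R`),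
  **`eq_of_mem_normTransversal`** (`hB₀inj`), **`exists_mem_normTransversal`** (`hB₀cov`).
* §3 Borel structure: `measurableSet_setOf_isRegularElt_subgroup`, `measurable_normSheet`, **`measurableEmbedding_normSheet`** (Lusin–Souslin), **`measurableSet_normTransversal`**.
* §4 = the sequel `R90S4NormSheetMeasure` (THE SHEET MEASURE `λ = Σ_{u ∈ R} map σ_u (t_T|_{reg})`: `lintegral_normSheets`, `integral_normSheets`, `normSheets_apply`,
  `setLIntegral_normSheets_image`, `normSheets_apply_compl_normTransversal`, `sigmaFinite_normSheets`) — split off by the 400-line rule.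

HONEST LABEL: HC_CM is proved only modulo the 7 printed citations (2 remaining named inputs: hLiu418 = stmt-HodgeConjecture-24832, h413 =
stmt-HodgeConjecture-24833) until rung 0 closes.  Group algebra on `T̃` + descriptive measure theory; (L1)∕λ are inputs of the (B1) assembly behind the OPEN (W-NP); this file
discharges no socket by itself (REL ≠ ★ ≠ BUILT).

[cite: Rogawski1990, §12.5 p. 186; §3.11 Prop. 3.11.1 (a)–(c), Prop. 3.11.2 pp. 34–35] [cite: HarishChandra1970, Lemma 42] [cite: Kechris1995, Thm. 15.1]
-/

set_option autoImplicit false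
-- the mandated namespace repeats the single-problem summit's segment (`HodgeConjecture.HodgeConjecture`)
set_option linter.dupNamespace false

noncomputable section

open MeasureTheory Measure Set Filter Topology Function NumberField IsDedekindDomain
open scoped ENNReal NNReal MatrixGroups

namespace Summit.HodgeConjecture.HodgeConjecture.R90.S4

open Literature.NumberTheory.Rogawski1990 Literature.NumberTheory.Rogawski1990.Ch4Sec10
open Literature.NumberTheory.Automorphic Literature.NumberTheory.Automorphic.UnitaryGroup

variable (L : Type) [Field L] [NumberField L] [IsCMField L] (v : HeightOneSpectrum (𝓞 ↥(maximalRealSubfield L)))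

/-! ## §0 The sheet map `σ_u : t ↦ s(t)·u` into `T̃` (hypothesis-first; here is one) -/

/-- **A SHEET MAP EXISTS**: for a section `s : T → G̃_v` with values in `T̃ = Cent_{G̃_v}(γ)` there is `σ : G̃_v → T → T̃` with `σ u t = s(t)·u` for every `u ∈ T̃` (classical
`dite`; off `T̃` the value is irrelevant).  All heads below are stated over ANY such `(σ, hσ)`. [cite: Rogawski1990, §12.5 p. 186] -/
theorem exists_normSheetMap (γ : Gqs L v) (T : Subgroup (Gqs L v)) (s : ↥T → GtLoc L v)
    (hsT : ∀ t, s t ∈ Subgroup.centralizer ({(γ.val : GtLoc L v)} : Set (GtLoc L v))) :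
    ∃ σ : GtLoc L v → ↥T → ↥(Subgroup.centralizer ({(γ.val : GtLoc L v)} : Set (GtLoc L v))),
      ∀ u ∈ Subgroup.centralizer ({(γ.val : GtLoc L v)} : Set (GtLoc L v)), ∀ t : ↥T,
        ((σ u t : ↥(Subgroup.centralizer ({(γ.val : GtLoc L v)} : Set (GtLoc L v)))) : GtLoc L v) = s t * u := by
  classical
  refine ⟨fun u t => if hu : u ∈ Subgroup.centralizer ({(γ.val : GtLoc L v)} : Set (GtLoc L v)) then ⟨s t * u, Subgroup.mul_mem _ (hsT t) hu⟩
    else ⟨s t, hsT t⟩, fun u hu t => ?_⟩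
  simp only [dif_pos hu]

/-! ## §1 Norms, injectivity and disjointness of the sheets -/

/-- **`N(σ_u t) = t`** for `u ∈ T̃ᴺ` (`u ∈ T̃`, `N u = 1`): `N(s(t)·u) = N(s t)·N(u) = t` (`N` multiplicative on the abelian `T̃`, ★ `epsNorm_mul_of_mem_centralizer`).
[cite: Rogawski1990, §12.5 p. 186; §3.11 Prop. 3.11.1 (a) p. 34] -/
theorem epsNorm_coe_normSheet {γ : Gqs L v} (hγ : IsRegularElt (γ.val : GtLoc L v)) {T : Subgroup (Gqs L v)} {s : ↥T → GtLoc L v}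
    (hsT : ∀ t, s t ∈ Subgroup.centralizer ({(γ.val : GtLoc L v)} : Set (GtLoc L v)))
    (hsN : ∀ t, epsNorm (epsLoc L (splitFormGL L) v) (s t) = ((t : Gqs L v)).val)
    {σ : GtLoc L v → ↥T → ↥(Subgroup.centralizer ({(γ.val : GtLoc L v)} : Set (GtLoc L v)))}
    (hσ : ∀ u ∈ Subgroup.centralizer ({(γ.val : GtLoc L v)} : Set (GtLoc L v)), ∀ t : ↥T,
      ((σ u t : ↥(Subgroup.centralizer ({(γ.val : GtLoc L v)} : Set (GtLoc L v)))) : GtLoc L v) = s t * u)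
    {u : GtLoc L v} (hu : u ∈ Subgroup.centralizer ({(γ.val : GtLoc L v)} : Set (GtLoc L v))) (hNu : epsNorm (epsLoc L (splitFormGL L) v) u = 1) (t : ↥T) :
    epsNorm (epsLoc L (splitFormGL L) v) ((σ u t : ↥(Subgroup.centralizer ({(γ.val : GtLoc L v)} : Set (GtLoc L v)))) : GtLoc L v) = ((t : Gqs L v)).val := by
  rw [hσ u hu t, epsNorm_mul_of_mem_centralizer (Φ := splitFormGL L) hγ (hsT t) hu, hNu, mul_one, hsN t]

/-- **Each sheet `σ_u` (`u ∈ T̃`) is INJECTIVE**: `s(t)·u = s(t′)·u ⇒ s t = s t′ ⇒ t = N(s t) = N(s t′) = t′`. [cite: Rogawski1990, §12.5 p. 186] -/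
theorem normSheet_injective {γ : Gqs L v} {T : Subgroup (Gqs L v)} {s : ↥T → GtLoc L v}
    (hsN : ∀ t, epsNorm (epsLoc L (splitFormGL L) v) (s t) = ((t : Gqs L v)).val)
    {σ : GtLoc L v → ↥T → ↥(Subgroup.centralizer ({(γ.val : GtLoc L v)} : Set (GtLoc L v)))}
    (hσ : ∀ u ∈ Subgroup.centralizer ({(γ.val : GtLoc L v)} : Set (GtLoc L v)), ∀ t : ↥T,
      ((σ u t : ↥(Subgroup.centralizer ({(γ.val : GtLoc L v)} : Set (GtLoc L v)))) : GtLoc L v) = s t * u)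
    {u : GtLoc L v} (hu : u ∈ Subgroup.centralizer ({(γ.val : GtLoc L v)} : Set (GtLoc L v))) :
    Injective (σ u) := by
  intro t t' h
  have h1 : s t * u = s t' * u := by rw [← hσ u hu t, ← hσ u hu t', h]
  have h2 : s t = s t' := mul_right_cancel h1
  have h3 : ((t : Gqs L v)).val = ((t' : Gqs L v)).val := by rw [← hsN t, ← hsN t', h2]
  exact Subtype.ext (Subtype.ext h3)

/-- **Distinct kernel representatives give DISJOINT sheets**: if `u, u′ ∈ T̃ᴺ` and `σ_u t = σ_{u′} t′` then `t = t′` (norms) and `u = u′` (cancel `s t`).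
[cite: Rogawski1990, §12.5 p. 186] -/
theorem disjoint_range_normSheet {γ : Gqs L v} (hγ : IsRegularElt (γ.val : GtLoc L v)) {T : Subgroup (Gqs L v)} {s : ↥T → GtLoc L v}
    (hsT : ∀ t, s t ∈ Subgroup.centralizer ({(γ.val : GtLoc L v)} : Set (GtLoc L v)))
    (hsN : ∀ t, epsNorm (epsLoc L (splitFormGL L) v) (s t) = ((t : Gqs L v)).val)
    {σ : GtLoc L v → ↥T → ↥(Subgroup.centralizer ({(γ.val : GtLoc L v)} : Set (GtLoc L v)))}
    (hσ : ∀ u ∈ Subgroup.centralizer ({(γ.val : GtLoc L v)} : Set (GtLoc L v)), ∀ t : ↥T,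
      ((σ u t : ↥(Subgroup.centralizer ({(γ.val : GtLoc L v)} : Set (GtLoc L v)))) : GtLoc L v) = s t * u)
    {u u' : GtLoc L v}
    (hu : u ∈ Subgroup.centralizer ({(γ.val : GtLoc L v)} : Set (GtLoc L v)) ∧ epsNorm (epsLoc L (splitFormGL L) v) u = 1)
    (hu' : u' ∈ Subgroup.centralizer ({(γ.val : GtLoc L v)} : Set (GtLoc L v)) ∧ epsNorm (epsLoc L (splitFormGL L) v) u' = 1) (hne : u ≠ u') :
    Disjoint (range (σ u)) (range (σ u')) := by
  refine disjoint_left.2 fun b hb hb' => hne ?_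
  obtain ⟨t, rfl⟩ := hb
  obtain ⟨t', ht'⟩ := hb'
  have hN := congrArg (fun x : ↥(Subgroup.centralizer ({(γ.val : GtLoc L v)} : Set (GtLoc L v))) => epsNorm (epsLoc L (splitFormGL L) v) (x : GtLoc L v)) ht'
  rw [epsNorm_coe_normSheet L v hγ hsT hsN hσ hu'.1 hu'.2 t', epsNorm_coe_normSheet L v hγ hsT hsN hσ hu.1 hu.2 t] at hN
  have htt : t' = t := Subtype.ext (Subtype.ext hN)
  subst htt
  have h := congrArg Subtype.val ht'
  rw [hσ u' hu'.1 t', hσ u hu.1 t'] at h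
  exact (mul_left_cancel h).symm

/-! ## §2 The (L1) letters of ★ M1-TWIST for `B₀ := ⋃_{u ∈ R} σ_u(T^{reg})`, at `A := T̃`, `θ := ε_v`, `R := {δ | IsEpsRegularAt δ}` -/

/-- **`hB₀R` — `B₀ ⊆ T̃^{ε-reg}`**: `N(σ_u t) = t` is regular for `t ∈ T^{reg}` (★ `isEpsRegularAt_iff`).  Shape = ★ p864149's `hB₀R : ∀ t ∈ B₀, (t : G) ∈ R` at
`R := {δ | IsEpsRegularAt L (splitFormGL L) v δ}`. [cite: Rogawski1990, §12.5 p. 186; §3.11 p. 34] -/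
theorem normTransversal_mem_setOf_isEpsRegularAt {γ : Gqs L v} (hγ : IsRegularElt (γ.val : GtLoc L v)) {T : Subgroup (Gqs L v)} {s : ↥T → GtLoc L v}
    (hsT : ∀ t, s t ∈ Subgroup.centralizer ({(γ.val : GtLoc L v)} : Set (GtLoc L v)))
    (hsN : ∀ t, epsNorm (epsLoc L (splitFormGL L) v) (s t) = ((t : Gqs L v)).val)
    {σ : GtLoc L v → ↥T → ↥(Subgroup.centralizer ({(γ.val : GtLoc L v)} : Set (GtLoc L v)))}
    (hσ : ∀ u ∈ Subgroup.centralizer ({(γ.val : GtLoc L v)} : Set (GtLoc L v)), ∀ t : ↥T,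
      ((σ u t : ↥(Subgroup.centralizer ({(γ.val : GtLoc L v)} : Set (GtLoc L v)))) : GtLoc L v) = s t * u)
    (R : Finset (GtLoc L v))
    (hRT : ∀ r ∈ R, r ∈ Subgroup.centralizer ({(γ.val : GtLoc L v)} : Set (GtLoc L v)) ∧ epsNorm (epsLoc L (splitFormGL L) v) r = 1) :
    ∀ b ∈ ⋃ u ∈ R, σ u '' {t : ↥T | IsRegularElt (((t : Gqs L v)).val : GtLoc L v)},
      ((b : ↥(Subgroup.centralizer ({(γ.val : GtLoc L v)} : Set (GtLoc L v)))) : GtLoc L v) ∈ {δ : GtLoc L v | IsEpsRegularAt L (splitFormGL L) v δ} := by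
  intro b hb
  simp only [mem_iUnion, mem_image, mem_setOf_eq, exists_prop] at hb
  obtain ⟨u, hu, t, ht, rfl⟩ := hb
  rw [mem_setOf_eq, isEpsRegularAt_iff, epsNorm_coe_normSheet L v hγ hsT hsN hσ (hRT u hu).1 (hRT u hu).2 t]
  exact ht

/-- **`hB₀inj` — TRANSVERSALITY**: two points of `B₀` differing by an element of `(1−ε)T̃ = {a ε(a)⁻¹ : a ∈ T̃}` are EQUAL.  If `s(r′)u′ = s(r)u · aε(a)⁻¹` then taking norms
(`N(aε(a)⁻¹) = 1`, ★ `epsNorm_mul_epsLoc_inv`; `N u = N u′ = 1`) gives `r′ = r`, cancelling `s(r)` gives `u′ = u · aε(a)⁻¹`, and `hRinj` gives `u = u′`.  Shape = ★ p864149's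
`hB₀inj : ∀ t ∈ B₀, ∀ t' ∈ B₀, (∃ a ∈ A, ((t' : A) : G) = t * (a * (θ a)⁻¹)) → t = t'`. [cite: Rogawski1990, §12.5 p. 186; §3.11 Prop. 3.11.1 (c) p. 34] [cite: HarishChandra1970, Lemma 42] -/
theorem eq_of_mem_normTransversal {γ : Gqs L v} (hγ : IsRegularElt (γ.val : GtLoc L v)) {T : Subgroup (Gqs L v)} {s : ↥T → GtLoc L v}
    (hsT : ∀ t, s t ∈ Subgroup.centralizer ({(γ.val : GtLoc L v)} : Set (GtLoc L v)))
    (hsN : ∀ t, epsNorm (epsLoc L (splitFormGL L) v) (s t) = ((t : Gqs L v)).val)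
    {σ : GtLoc L v → ↥T → ↥(Subgroup.centralizer ({(γ.val : GtLoc L v)} : Set (GtLoc L v)))}
    (hσ : ∀ u ∈ Subgroup.centralizer ({(γ.val : GtLoc L v)} : Set (GtLoc L v)), ∀ t : ↥T,
      ((σ u t : ↥(Subgroup.centralizer ({(γ.val : GtLoc L v)} : Set (GtLoc L v)))) : GtLoc L v) = s t * u)
    (R : Finset (GtLoc L v))
    (hRT : ∀ r ∈ R, r ∈ Subgroup.centralizer ({(γ.val : GtLoc L v)} : Set (GtLoc L v)) ∧ epsNorm (epsLoc L (splitFormGL L) v) r = 1)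
    (hRinj : ∀ r ∈ R, ∀ r' ∈ R,
      (∃ s ∈ Subgroup.centralizer ({(γ.val : GtLoc L v)} : Set (GtLoc L v)), r' = r * (s * (epsLoc L (splitFormGL L) v s)⁻¹)) → r = r') :
    ∀ b ∈ ⋃ u ∈ R, σ u '' {t : ↥T | IsRegularElt (((t : Gqs L v)).val : GtLoc L v)},
      ∀ b' ∈ ⋃ u ∈ R, σ u '' {t : ↥T | IsRegularElt (((t : Gqs L v)).val : GtLoc L v)},
        (∃ a ∈ Subgroup.centralizer ({(γ.val : GtLoc L v)} : Set (GtLoc L v)),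
          ((b' : ↥(Subgroup.centralizer ({(γ.val : GtLoc L v)} : Set (GtLoc L v)))) : GtLoc L v) =
            (b : GtLoc L v) * (a * (epsLoc L (splitFormGL L) v a)⁻¹)) → b = b' := by
  intro b hb b' hb' hrel
  simp only [mem_iUnion, mem_image, mem_setOf_eq, exists_prop] at hb hb'
  obtain ⟨u, hu, r, -, rfl⟩ := hb
  obtain ⟨u', hu', r', -, rfl⟩ := hb'
  obtain ⟨a, ha, heq⟩ := hrel
  rw [hσ u' (hRT u' hu').1 r', hσ u (hRT u hu).1 r] at heq
  -- `heq : s r' * u' = s r * u * (a * (ε a)⁻¹)`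
  have haC : a * (epsLoc L (splitFormGL L) v a)⁻¹ ∈ Subgroup.centralizer ({(γ.val : GtLoc L v)} : Set (GtLoc L v)) :=
    Subgroup.mul_mem _ ha (Subgroup.inv_mem _ (epsLoc_mem_centralizer_coe (Φ := splitFormGL L) γ ha))
  have hN := congrArg (epsNorm (epsLoc L (splitFormGL L) v)) heq
  rw [epsNorm_mul_of_mem_centralizer (Φ := splitFormGL L) hγ (hsT r') (hRT u' hu').1, (hRT u' hu').2, mul_one, hsN r',
    epsNorm_mul_of_mem_centralizer (Φ := splitFormGL L) hγ (Subgroup.mul_mem _ (hsT r) (hRT u hu).1) haC,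
    epsNorm_mul_of_mem_centralizer (Φ := splitFormGL L) hγ (hsT r) (hRT u hu).1, (hRT u hu).2, mul_one, hsN r,
    epsNorm_mul_epsLoc_inv (splitFormGL_isHermitian L) a, mul_one] at hN
  -- `hN : ↑r' = ↑r` as elements of `G̃_v`
  have hrr : r' = r := Subtype.ext (Subtype.ext hN)
  subst hrr
  have hu_eq : u' = u * (a * (epsLoc L (splitFormGL L) v a)⁻¹) := by
    rw [mul_assoc] at heq
    exact mul_left_cancel heq
  have huu : u = u' := hRinj u hu u' hu' ⟨a, ha, hu_eq⟩
  subst huu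
  rfl

/-- **`hB₀cov` — `B₀` MEETS EVERY `(1−ε)T̃`-COSET OF `T̃^{ε-reg}`**: for `b ∈ T̃` ε-regular, `N b ∈ T̃ ∩ G_v = T` (★ `exists_centralizer_coe_eq_epsNorm`, here `hT` is used as
an EQUALITY) is a regular point `t`, `u := s(t)⁻¹ b ∈ T̃ᴺ` (★ `epsNorm_eq_one_of_mem_normFibre` over the regular `t`), so `u = r · cε(c)⁻¹` (`hRcov`) and
`b₀ := σ_r t = s(t) r = b · (εc) ε(εc)⁻¹` (`ε ∘ ε = 1`, ★ `twistLocal_twistLocal_cm`) with `εc ∈ T̃`.  Shape = ★ p864149's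
`hB₀cov : ∀ t : A, (t : G) ∈ R → ∃ t₀ ∈ B₀, ∃ a ∈ A, ((t₀ : A) : G) = t * (a * (θ a)⁻¹)`. [cite: Rogawski1990, §12.5 p. 186; §3.11 Prop. 3.11.1 (a)(c), Prop. 3.11.2 pp. 34–35] -/
theorem exists_mem_normTransversal {γ : Gqs L v} (hγ : IsRegularElt (γ.val : GtLoc L v)) {T : Subgroup (Gqs L v)}
    (hT : T = Subgroup.centralizer ({γ} : Set (Gqs L v))) {s : ↥T → GtLoc L v}
    (hsT : ∀ t, s t ∈ Subgroup.centralizer ({(γ.val : GtLoc L v)} : Set (GtLoc L v)))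
    (hsN : ∀ t, epsNorm (epsLoc L (splitFormGL L) v) (s t) = ((t : Gqs L v)).val)
    {σ : GtLoc L v → ↥T → ↥(Subgroup.centralizer ({(γ.val : GtLoc L v)} : Set (GtLoc L v)))}
    (hσ : ∀ u ∈ Subgroup.centralizer ({(γ.val : GtLoc L v)} : Set (GtLoc L v)), ∀ t : ↥T,
      ((σ u t : ↥(Subgroup.centralizer ({(γ.val : GtLoc L v)} : Set (GtLoc L v)))) : GtLoc L v) = s t * u)
    (R : Finset (GtLoc L v))
    (hRT : ∀ r ∈ R, r ∈ Subgroup.centralizer ({(γ.val : GtLoc L v)} : Set (GtLoc L v)) ∧ epsNorm (epsLoc L (splitFormGL L) v) r = 1)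
    (hRcov : ∀ u ∈ Subgroup.centralizer ({(γ.val : GtLoc L v)} : Set (GtLoc L v)), epsNorm (epsLoc L (splitFormGL L) v) u = 1 →
      ∃ r ∈ R, ∃ s ∈ Subgroup.centralizer ({(γ.val : GtLoc L v)} : Set (GtLoc L v)), u = r * (s * (epsLoc L (splitFormGL L) v s)⁻¹)) :
    ∀ b : ↥(Subgroup.centralizer ({(γ.val : GtLoc L v)} : Set (GtLoc L v))),
      ((b : ↥(Subgroup.centralizer ({(γ.val : GtLoc L v)} : Set (GtLoc L v)))) : GtLoc L v) ∈ {δ : GtLoc L v | IsEpsRegularAt L (splitFormGL L) v δ} →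
        ∃ b₀ ∈ ⋃ u ∈ R, σ u '' {t : ↥T | IsRegularElt (((t : Gqs L v)).val : GtLoc L v)},
          ∃ a ∈ Subgroup.centralizer ({(γ.val : GtLoc L v)} : Set (GtLoc L v)),
            ((b₀ : ↥(Subgroup.centralizer ({(γ.val : GtLoc L v)} : Set (GtLoc L v)))) : GtLoc L v) =
              (b : GtLoc L v) * (a * (epsLoc L (splitFormGL L) v a)⁻¹) := by
  intro b hb
  rw [mem_setOf_eq, isEpsRegularAt_iff] at hb
  -- the norm of `b` is a (regular) point of `T = Cent_{G_v}(γ)`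
  obtain ⟨t', ht'⟩ := exists_centralizer_coe_eq_epsNorm (splitFormGL_isHermitian L) hγ b.2
  have ht'T : ((t' : ↥(Subgroup.centralizer ({γ} : Set (Gqs L v)))) : Gqs L v) ∈ T := by
    rw [hT]
    exact t'.2
  set t : ↥T := ⟨((t' : ↥(Subgroup.centralizer ({γ} : Set (Gqs L v)))) : Gqs L v), ht'T⟩ with ht_def
  have htval : ((t : Gqs L v)).val = epsNorm (epsLoc L (splitFormGL L) v) (b : GtLoc L v) := ht'
  have htreg : IsRegularElt (((t : Gqs L v)).val : GtLoc L v) := by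
    rw [htval]
    exact hb
  -- `u := s(t)⁻¹ b ∈ T̃ᴺ`
  obtain ⟨-, hNu⟩ := epsNorm_eq_one_of_mem_normFibre (Φ := splitFormGL L) (splitFormGL_isHermitian L) (γ := (t : Gqs L v)) htreg (hsN t) htval.symm
  have huT : (s t)⁻¹ * (b : GtLoc L v) ∈ Subgroup.centralizer ({(γ.val : GtLoc L v)} : Set (GtLoc L v)) :=
    Subgroup.mul_mem _ (Subgroup.inv_mem _ (hsT t)) b.2
  obtain ⟨r, hr, c, hc, hu⟩ := hRcov _ huT hNu
  -- `b = s(t) · r · cε(c)⁻¹`, so `b₀ := σ_r t = b · (εc)·ε(εc)⁻¹`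
  have hε : epsLoc L (splitFormGL L) v (epsLoc L (splitFormGL L) v c) = c := twistLocal_twistLocal_cm L 3 (splitFormGL L) (splitFormGL_isHermitian L) v c
  have hb' : (b : GtLoc L v) = s t * (r * (c * (epsLoc L (splitFormGL L) v c)⁻¹)) := by
    rw [← hu, mul_inv_cancel_left]
  refine ⟨σ r t, ?_, epsLoc L (splitFormGL L) v c, epsLoc_mem_centralizer_coe (Φ := splitFormGL L) γ hc, ?_⟩
  · simp only [mem_iUnion, mem_image, mem_setOf_eq, exists_prop]
    exact ⟨r, hr, t, htreg, rfl⟩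
  · rw [hσ r (hRT r hr).1 t, hε, hb']
    group

/-! ## §3 Borel structure: the sheets are measurable embeddings of the standard Borel `T`; `B₀` is Borel -/

/-- **`T^{reg}` is a Borel subset of `T`** (`v` non-split): the regular locus of `G_v` is open (★ `isOpen_setOf_isRegularElt_cmDatum_local`), pulled back along the
continuous inclusion `T ↪ G_v`. [cite: Rogawski1990, §3.1 p. 19] -/
theorem measurableSet_setOf_isRegularElt_subgroup (hns : ∀ w : PlacesOver L v, IsCMField.complexConj L • w.1 = w.1)
    [MeasurableSpace (Gqs L v)] [BorelSpace (Gqs L v)] (T : Subgroup (Gqs L v)) :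
    MeasurableSet {t : ↥T | IsRegularElt (((t : Gqs L v)).val : GtLoc L v)} := by
  obtain ⟨w⟩ := (inferInstance : Nonempty (PlacesOver L v))
  exact ((isOpen_setOf_isRegularElt_cmDatum_local (L := L) (H := qsForm L) (v := v) w (hns w)).preimage continuous_subtype_val).measurableSet

/-- **Each sheet `σ_u` (`u ∈ T̃`) is Borel** (`t ↦ s(t)·u` is measurable for a measurable `s`; the σ-algebra of `T̃` is the subspace one). [cite: Kechris1995, Thm. 15.1] -/
theorem measurable_normSheet [MeasurableSpace (GtLoc L v)] [BorelSpace (GtLoc L v)] [MeasurableSpace (Gqs L v)]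
    {γ : Gqs L v} {T : Subgroup (Gqs L v)} {s : ↥T → GtLoc L v} (hsm : Measurable s)
    (hsT : ∀ t, s t ∈ Subgroup.centralizer ({(γ.val : GtLoc L v)} : Set (GtLoc L v)))
    {σ : GtLoc L v → ↥T → ↥(Subgroup.centralizer ({(γ.val : GtLoc L v)} : Set (GtLoc L v)))}
    (hσ : ∀ u ∈ Subgroup.centralizer ({(γ.val : GtLoc L v)} : Set (GtLoc L v)), ∀ t : ↥T,
      ((σ u t : ↥(Subgroup.centralizer ({(γ.val : GtLoc L v)} : Set (GtLoc L v)))) : GtLoc L v) = s t * u)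
    {u : GtLoc L v} (hu : u ∈ Subgroup.centralizer ({(γ.val : GtLoc L v)} : Set (GtLoc L v))) :
    Measurable (σ u) := by
  have hfun : σ u = fun t => (⟨s t * u, Subgroup.mul_mem _ (hsT t) hu⟩ : ↥(Subgroup.centralizer ({(γ.val : GtLoc L v)} : Set (GtLoc L v)))) :=
    funext fun t => Subtype.ext (hσ u hu t)
  rw [hfun]
  exact (hsm.mul_const u).subtype_mk

/-- **LUSIN–SOUSLIN: each sheet `σ_u` (`u ∈ T̃`) is a MEASURABLE EMBEDDING `T ↪ T̃`.**  `T = Cent_{G_v}(γ)` is closed in the locally compact second countable Hausdorff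
group `G_v`, hence a standard Borel space (★ `polishSpace_of_locallyCompactSpace_of_secondCountableTopology`, Mathlib `MeasurableSet.standardBorel`); `T̃ ⊆ G̃_v` is
countably separated; an injective Borel map from a standard Borel space into a countably separated space is a measurable embedding (Mathlib `Measurable.measurableEmbedding`).
[cite: Kechris1995, Thm. 15.1] [cite: Rogawski1990, §12.5 p. 186] -/
theorem measurableEmbedding_normSheet [MeasurableSpace (GtLoc L v)] [BorelSpace (GtLoc L v)] [SecondCountableTopology (GtLoc L v)] [T2Space (GtLoc L v)]
    [MeasurableSpace (Gqs L v)] [BorelSpace (Gqs L v)]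
    {γ : Gqs L v} {T : Subgroup (Gqs L v)} (hT : T = Subgroup.centralizer ({γ} : Set (Gqs L v))) {s : ↥T → GtLoc L v} (hsm : Measurable s)
    (hsT : ∀ t, s t ∈ Subgroup.centralizer ({(γ.val : GtLoc L v)} : Set (GtLoc L v)))
    (hsN : ∀ t, epsNorm (epsLoc L (splitFormGL L) v) (s t) = ((t : Gqs L v)).val)
    {σ : GtLoc L v → ↥T → ↥(Subgroup.centralizer ({(γ.val : GtLoc L v)} : Set (GtLoc L v)))}
    (hσ : ∀ u ∈ Subgroup.centralizer ({(γ.val : GtLoc L v)} : Set (GtLoc L v)), ∀ t : ↥T,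
      ((σ u t : ↥(Subgroup.centralizer ({(γ.val : GtLoc L v)} : Set (GtLoc L v)))) : GtLoc L v) = s t * u)
    {u : GtLoc L v} (hu : u ∈ Subgroup.centralizer ({(γ.val : GtLoc L v)} : Set (GtLoc L v))) :
    MeasurableEmbedding (σ u) := by
  haveI : PolishSpace (Gqs L v) := Literature.Topology.Metrizable.polishSpace_of_locallyCompactSpace_of_secondCountableTopology _
  have hTc : IsClosed (T : Set (Gqs L v)) := by
    rw [hT]
    exact Set.isClosed_centralizer _
  haveI : StandardBorelSpace ↥T := hTc.measurableSet.standardBorel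
  exact (measurable_normSheet L v hsm hsT hσ hu).measurableEmbedding (normSheet_injective L v hsN hσ hu)

/-- **(L1) IS BOREL: `B₀ = ⋃_{u ∈ R} σ_u(T^{reg})` is a measurable subset of `T̃`** — a finite union of images of the Borel `T^{reg}` under measurable embeddings.
[cite: Kechris1995, Thm. 15.1] [cite: Rogawski1990, §12.5 p. 186] -/
theorem measurableSet_normTransversal (hns : ∀ w : PlacesOver L v, IsCMField.complexConj L • w.1 = w.1)
    [MeasurableSpace (GtLoc L v)] [BorelSpace (GtLoc L v)] [SecondCountableTopology (GtLoc L v)] [T2Space (GtLoc L v)]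
    [MeasurableSpace (Gqs L v)] [BorelSpace (Gqs L v)]
    {γ : Gqs L v} {T : Subgroup (Gqs L v)} (hT : T = Subgroup.centralizer ({γ} : Set (Gqs L v))) {s : ↥T → GtLoc L v} (hsm : Measurable s)
    (hsT : ∀ t, s t ∈ Subgroup.centralizer ({(γ.val : GtLoc L v)} : Set (GtLoc L v)))
    (hsN : ∀ t, epsNorm (epsLoc L (splitFormGL L) v) (s t) = ((t : Gqs L v)).val)
    {σ : GtLoc L v → ↥T → ↥(Subgroup.centralizer ({(γ.val : GtLoc L v)} : Set (GtLoc L v)))}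
    (hσ : ∀ u ∈ Subgroup.centralizer ({(γ.val : GtLoc L v)} : Set (GtLoc L v)), ∀ t : ↥T,
      ((σ u t : ↥(Subgroup.centralizer ({(γ.val : GtLoc L v)} : Set (GtLoc L v)))) : GtLoc L v) = s t * u)
    (R : Finset (GtLoc L v))
    (hRT : ∀ r ∈ R, r ∈ Subgroup.centralizer ({(γ.val : GtLoc L v)} : Set (GtLoc L v)) ∧ epsNorm (epsLoc L (splitFormGL L) v) r = 1) :
    MeasurableSet (⋃ u ∈ R, σ u '' {t : ↥T | IsRegularElt (((t : Gqs L v)).val : GtLoc L v)}) := by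
  refine Finset.measurableSet_biUnion R fun u hu => ?_
  exact (measurableEmbedding_normSheet L v hT hsm hsT hsN hσ (hRT u hu).1).measurableSet_image.2
    (measurableSet_setOf_isRegularElt_subgroup L v hns T)

end Summit.HodgeConjecture.HodgeConjecture.R90.S4

end
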